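import Summits.BirchSwinnertonDyer.BirchSwinnertonDyer.Theorems.RamifiedSevenEllipticUnitsQuadraticRamificationOfPinning
import Summits.BirchSwinnertonDyer.BirchSwinnertonDyer.Theorems.RamifiedSevenEllipticUnitsPinnedCharacterRigiditySeven
import Literature.NumberTheory.EllipticCurves.RankinSelbergBaseChangeHeckeValueProofs
import Literature.NumberTheory.LFunctions.KroneckerCharacter
import Literature.NumberTheory.Automorphic.ShimuraCurveRibetTakahashiPeterssonTwistDescentProofs
import Literature.NumberTheory.EllipticCurves.ComplexMultiplicationShaKnappProofs
import Literature.NumberTheory.EllipticCurves.LFunctionSmulProofs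
import Literature.NumberTheory.EllipticCurves.X049CanonicalPAdicHeightSqTwoProofs
import Literature.NumberTheory.EllipticCurves.HeegnerPointsKolyvaginGoodReductionProofs
import Literature.NumberTheory.EllipticCurves.ComplexMultiplicationTwistIsogenyProofs
import HarnessLib

set_option linter.dupNamespace false
set_option autoImplicit false

/-!
# K7r value crux `EllipticUnitValueSevenOfGZK` (stmt-BirchSwinnertonDyer-19945), line `rubin-formula-zp`
# v4.4 — TWIST TRANSPORT OF A PINNED CHARACTER, PART 1: the Kronecker Hecke character, the pinning
# read at split / inert primes, and the base curve `cm7 = 49a1`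
# (cell `bsd-cm`, seat `bsd-cm-k7r-c2` g13; helper, `--supports` 19945; nothing about BSD asserted)

HONEST FRAMING. In skeleton v4.4 (`78d3f8f5baabbaa8`) the derived node H_QR
(`X12.O11.RamifiedCMQuadraticRamificationAtZp W 7`) is a theorem modulo the PRINT fact
`Deuring_exists_heckeCharacter_of_maximalCM_withUnitValues` (clause (vii): the values of the
Grössencharacter on local units are units of `𝓞_K`, Silverman ATAEC II Thm. 9.1 (i)) and the registered
pure-rigidity bridge H_Rig⁰ (a tree theorem since p515907). This file and its sequel
`…QuadraticRamificationAwayOfTwist` prove the AWAY-FROM-`𝔭` half of H_QR — indeed «`ψ²` unramified at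
EVERY place `w ∌ 7`» — from the PLAIN Deuring fact `Deuring_exists_heckeCharacter_of_maximalCM` (clauses
(iii) «unramified ↔ good reduction» and (v) «`L(ψ₇, s) = L(49a1, s)`» at the SINGLE curve `cm7`), the kernel
rigidity theorem `Rigidity.eq_or_eq_galConj_of_valuePairs`, and the tree's quadratic-twist calculus; so
clause (vii) is idle away from `𝔭`. THIS FILE (the inputs of the transport):

* §1 `TwistTransport.kroneckerChar_prime_and_sq`, `…ofDirichlet_sq_eq_one`,
  `…compRelNorm_ofDirichlet_sq_eq_one` — the Kronecker character `(D/·)` (`kroneckerChar D`, `D ≡ 1 (4)`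
  or fundamental) has the value `(D/ℓ)` at odd primes and its Hecke character `ψ_{(D/·)} ∘ N_{K/ℚ}`
  squares to `1`;
* §2 `TwistTransport.coeff_of_pinned_split` / `…_inert` — if `heckeLFunction ψ s = V.LSeries s` on a
  half-plane then `a_ℓ(V) = ψ(w₁) + ψ(w₂)`, `a_{ℓ²}(V) = ψ(w₁)² + ψ(w₁)ψ(w₂) + ψ(w₂)²` at a split `ℓ` and
  `a_{ℓ²}(V) = ψ(w)` at an inert `ℓ` (seat k7r-c3 g13's
  `Rigidity.intCast_lFunction_eq_weightedCoeff_of_heckeLFunction_eq_LSeries` read with Ribet's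
  `finsum_absNorm_eq_prime_pow_of_pair/_singleton`); `…valuePair_of_pinned_twist_split`,
  `…value_of_pinned_twist_inert` — two pinned characters whose curves satisfy `a_ℓ(V) = J a_ℓ(V')`,
  `a_{ℓ²}(V) = a_{ℓ²}(V')`, `J² = 1`, have value pairs `{ψ(w₁), ψ(w₂)} = {Jψ'(w₁), Jψ'(w₂)}` (Vieta) and
  `ψ(w) = ψ'(w)` at inert `ℓ`;
* §3 `TwistTransport.exists_twistParam_of_j_eq` — a curve with `j = −3375` has
  `a_{ℓ^e} = (D/ℓ)^e a_{ℓ^e}(cm7)` at all odd `ℓ ∤ D` for some `D ≠ 0`, `D ≡ 1 (4)` or fundamental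
  (`exists_variableChange_eq_quadraticTwist_intCast_of_j_eq`, `LFunction_smul`,
  `LFunction_quadraticTwist_intCast_apply_prime_pow_of_not_dvd` — any reduction type);
  `…hasGoodReductionAt_baseChange_cm7` (`cm7_K` good at every `w ∌ 7`, `Δ = −7³`) and
  `…exists_pinned_cm7` — PLAIN Deuring's `ψ₇` for `cm7` over `K = ℚ(√−7)`: pinned to `cm7` and unramified
  at every `w ∌ 7`.
CONDITIONAL only where stated (`exists_pinned_cm7` on the plain Deuring fact); no definition, no new fact;
nothing about BSD.

References: [SilvermanATAEC1994] II 9.2, 10.5, App. A §3; [SilvermanAEC2009] X.2, X.5; [Ribet1977Nebentypus] §3;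
[NeukirchANT1999] VII (6.9), (8.1); [CasselsFrohlichANT1967] VII §6.3; [MontgomeryVaughan2007] §9.3;
[Cremona1997] Table 1; cell texts STATUS 2026-08-27 D184/D188/D189, k7r-c2 g13 10:02Z.
-/

noncomputable section

open scoped Classical NumberTheorySymbols
open Filter NumberField IsDedekindDomain WeierstrassCurve
  Literature.NumberTheory.GaloisRepresentations
  Literature.NumberTheory.LFunctions
  Literature.NumberTheory.LFunctions.KroneckerCharacter
  Literature.NumberTheory.EllipticCurves
  Literature.NumberTheory.EllipticCurves.ModularForms
  Literature.NumberTheory.EllipticCurves.Rank1Residual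
  Summit.BirchSwinnertonDyer.Rank1Residual Summit.BirchSwinnertonDyer.Rank1Residual.X12
  Summit.BirchSwinnertonDyer.Rank1Residual.X12.O11
open Literature.Barriers.RiemannHypothesis (IsFundamentalDiscriminant)

namespace Summit.BirchSwinnertonDyer.BirchSwinnertonDyer.Theorems.RamifiedSevenEllipticUnits

namespace TwistTransport

/-! ## §1. The Kronecker Hecke character `χ_D = ψ_{(D/·)} ∘ N_{K/ℚ}` -/

section Kronecker

/-- **Prime values of the Kronecker character.** For `D ≡ 1 (mod 4)` or `D` a fundamental
discriminant, `χ_D(ℓ) = (D/ℓ)` at every odd prime `ℓ`, and `χ_D` takes values of square one on units.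
[cite: MontgomeryVaughan2007, §9.3] -/
theorem kroneckerChar_prime_and_sq {D : ℤ} [NeZero D.natAbs]
    (hD : D % 4 = 1 ∨ IsFundamentalDiscriminant D) :
    (∀ ℓ : ℕ, ℓ.Prime → ℓ ≠ 2 → kroneckerChar D (ℓ : ZMod D.natAbs) = ((jacobiSym D ℓ : ℤ) : ℂ)) ∧
      ∀ u : (ZMod D.natAbs)ˣ, (kroneckerChar D (u : ZMod D.natAbs)) ^ 2 = 1 := by
  refine ⟨fun ℓ hℓ hℓ2 ↦ ?_, fun u ↦ ?_⟩
  · rcases hD with h1 | hf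
    · exact kroneckerChar_natCast_of_odd h1 hℓ hℓ2
    · exact (isKroneckerChar_kroneckerChar hf).2.1 ℓ hℓ hℓ2
  · have hne : kroneckerChar D (u : ZMod D.natAbs) ≠ 0 := by
      rw [← MulChar.coe_toUnitHom]; exact Units.ne_zero _
    rcases isQuadratic_kroneckerChar D (u : ZMod D.natAbs) with h | h | h
    · exact absurd h hne
    · rw [h, one_pow]
    · rw [h]; norm_num

variable {m : ℕ} [NeZero m]

/-- The Hecke character of a Dirichlet character whose unit values square to one squares to `1`.
[cite: NeukirchANT1999, Ch. VII Prop. (6.9)] -/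
theorem ofDirichlet_sq_eq_one (θ : DirichletCharacter ℂ m) (hθ : ∀ u : (ZMod m)ˣ, (θ (u : ZMod m)) ^ 2 = 1) :
    HeckeCharacter.ofDirichlet θ ^ 2 = 1 := by
  refine HeckeCharacter.ext fun x => ?_
  rw [HeckeCharacter.pow_apply, HeckeCharacter.ofDirichlet_apply, inv_pow, ← map_pow,
    HeckeCharacter.one_apply, inv_eq_one]
  apply Units.ext
  rw [MulChar.coe_toUnitHom, Units.val_pow_eq_pow_val, map_pow, Units.val_one]
  exact hθ _

/-- `(ψ_θ ∘ N_{K/ℚ})² = 1` under the same hypothesis. [cite: CasselsFrohlichANT1967, Ch. VII Prop. 4.3] -/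
theorem compRelNorm_ofDirichlet_sq_eq_one (K : Type) [Field K] [NumberField K] [IsGalois ℚ K]
    (θ : DirichletCharacter ℂ m) (hθ : ∀ u : (ZMod m)ˣ, (θ (u : ZMod m)) ^ 2 = 1) :
    (HeckeCharacter.ofDirichlet θ).compRelNorm K ^ 2 = 1 := by
  refine HeckeCharacter.ext fun y => ?_
  rw [HeckeCharacter.pow_apply, HeckeCharacter.compRelNorm_apply, ← HeckeCharacter.pow_apply,
    ofDirichlet_sq_eq_one θ hθ, HeckeCharacter.one_apply, HeckeCharacter.one_apply]

end Kronecker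

/-! ## §2. Coefficients of a pinned character at split and inert primes; comparison under a twist -/

section Pinned

variable {K : Type} [Field K] [NumberField K]

/-- **Pinning read at a split prime.** If `heckeLFunction ψ s = V.LSeries s` for `re s > s₀` (`V/ℚ` any
Weierstrass curve) and the rational place `v` (prime `ℓ`) splits in `K` as `{w₁, w₂}` (residue degrees
one) with `ψ` unramified at both, then `a_ℓ(V) = ψ(ϖ_{w₁}) + ψ(ϖ_{w₂})` and
`a_{ℓ²}(V) = ψ(ϖ_{w₁})² + ψ(ϖ_{w₁})ψ(ϖ_{w₂}) + ψ(ϖ_{w₂})²` (the ideals of norm `ℓ^e` are the `w₁^i w₂^{e−i}`).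
[cite: Ribet1977Nebentypus, §3 Thm. (3.4)] [cite: NeukirchANT1999, Ch. VII §8 (8.1)] -/
theorem coeff_of_pinned_split (ψ : HeckeCharacter K) (V : WeierstrassCurve ℚ) (s₀ : ℝ)
    (h : ∀ s : ℂ, s₀ < s.re → heckeLFunction ψ s = V.LSeries s)
    (v : HeightOneSpectrum (𝓞 ℚ)) {w₁ w₂ : HeightOneSpectrum (𝓞 K)} (hne : w₁ ≠ w₂)
    (hS : {w : HeightOneSpectrum (𝓞 K) | w.asIdeal.under (𝓞 ℚ) = v.asIdeal} = {w₁, w₂})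
    (h₁ : w₁.asIdeal.inertiaDeg (𝓞 ℚ) = 1) (h₂ : w₂.asIdeal.inertiaDeg (𝓞 ℚ) = 1)
    (hψ₁ : ψ.IsUnramifiedAt w₁) (hψ₂ : ψ.IsUnramifiedAt w₂) :
    ((V.LFunction (Rat.HeightOneSpectrum.natGenerator v) : ℤ) : ℂ) =
        ψ.valueAtUniformizer w₁ + ψ.valueAtUniformizer w₂ ∧
      ((V.LFunction (Rat.HeightOneSpectrum.natGenerator v ^ 2) : ℤ) : ℂ) =
        ψ.valueAtUniformizer w₁ ^ 2 + ψ.valueAtUniformizer w₁ * ψ.valueAtUniformizer w₂ +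
          ψ.valueAtUniformizer w₂ ^ 2 := by
  obtain ⟨σ, ψ₀, 𝔪, -, h𝔪, hiff, -, hval, hcoeff⟩ :=
    Rigidity.intCast_lFunction_eq_weightedCoeff_of_heckeLFunction_eq_LSeries ψ V s₀ h
  set ℓ : ℕ := Rat.HeightOneSpectrum.natGenerator v with hℓ
  have hℓp : ℓ.Prime := Rat.HeightOneSpectrum.prime_natGenerator v
  have hℓ0 : (ℓ : ℂ) ≠ 0 := by exact_mod_cast hℓp.ne_zero
  set g : Ideal (𝓞 K) →*₀ ℂ := rayClassCoeffHom 𝔪 fun v ↦ ψ₀.valueAtUniformizer v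
  have hmul : ∀ A B : Ideal (𝓞 K), A ≠ ⊥ → B ≠ ⊥ → g (A * B) = g A * g B := fun A B _ _ ↦ map_mul g A B
  have hone : g ⊤ = 1 := by rw [← Ideal.one_eq_top, map_one]
  have hsum : ∀ e : ℕ, NumberField.twistCount K g (ℓ ^ e) =
      ∑ i ∈ Finset.range (e + 1), g w₁.asIdeal ^ i * g w₂.asIdeal ^ (e - i) := by
    intro e
    rw [Rigidity.twistCount_eq_finsum, hℓ]
    exact finsum_absNorm_eq_prime_pow_of_pair g hmul hone v hne hS h₁ h₂ e
  have hg₁ : g w₁.asIdeal = ψ₀.valueAtUniformizer w₁ :=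
    Rigidity.rayClassCoeffHom_asIdeal _ ((hiff w₁).mp hψ₁) h𝔪
  have hg₂ : g w₂.asIdeal = ψ₀.valueAtUniformizer w₂ :=
    Rigidity.rayClassCoeffHom_asIdeal _ ((hiff w₂).mp hψ₂) h𝔪
  have hN : ∀ {w : HeightOneSpectrum (𝓞 K)}, w ∈ ({w₁, w₂} : Set (HeightOneSpectrum (𝓞 K))) →
      w.asIdeal.inertiaDeg (𝓞 ℚ) = 1 → ((Ideal.absNorm w.asIdeal : ℕ) : ℂ) = ℓ := by
    intro w hw hf
    have hw' : w.asIdeal.under (𝓞 ℚ) = v.asIdeal := by rw [← hS] at hw; exact hw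
    have := (absNorm_eq_natGenerator_iff (K := K) v w.asIdeal).mpr ⟨w, rfl, hw', hf⟩
    rw [this]
  have hN₁ : ((Ideal.absNorm w₁.asIdeal : ℕ) : ℂ) = ℓ := hN (by simp) h₁
  have hN₂ : ((Ideal.absNorm w₂.asIdeal : ℕ) : ℂ) = ℓ := hN (by simp) h₂
  set a := ψ.valueAtUniformizer w₁
  set b := ψ.valueAtUniformizer w₂
  have ha : ψ₀.valueAtUniformizer w₁ = a * (ℓ : ℂ) ^ (σ : ℂ) := by rw [hval, hN₁]
  have hb : ψ₀.valueAtUniformizer w₂ = b * (ℓ : ℂ) ^ (σ : ℂ) := by rw [hval, hN₂]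
  have hu : (ℓ : ℂ) ^ (σ : ℂ) ≠ 0 := fun h0 ↦ hℓ0 (Complex.cpow_eq_zero_iff _ _ |>.mp h0).1
  have hw1 : ((ℓ : ℕ) : ℂ) ^ (-(σ : ℂ)) = ((ℓ : ℂ) ^ (σ : ℂ))⁻¹ := Complex.cpow_neg _ _
  have hw2 : ((ℓ ^ 2 : ℕ) : ℂ) ^ (-(σ : ℂ)) = ((ℓ : ℂ) ^ (σ : ℂ))⁻¹ * ((ℓ : ℂ) ^ (σ : ℂ))⁻¹ := by
    rw [pow_two, Nat.cast_mul, Complex.natCast_mul_natCast_cpow, Complex.cpow_neg]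
  have hs1 : NumberField.twistCount K g ℓ = g w₂.asIdeal + g w₁.asIdeal := by
    have := hsum 1
    rw [pow_one] at this
    rw [this, Finset.sum_range_succ, Finset.sum_range_succ, Finset.sum_range_zero]
    simp
  have hs2 : NumberField.twistCount K g (ℓ ^ 2) =
      g w₂.asIdeal ^ 2 + g w₁.asIdeal * g w₂.asIdeal + g w₁.asIdeal ^ 2 := by
    rw [hsum 2, Finset.sum_range_succ, Finset.sum_range_succ, Finset.sum_range_succ,
      Finset.sum_range_zero]
    simp
  have e1 := hcoeff ℓ hℓp.ne_zero
  have e2 := hcoeff (ℓ ^ 2) (pow_ne_zero 2 hℓp.ne_zero)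
  rw [hs1, hg₁, hg₂, ha, hb, hw1] at e1
  rw [hs2, hg₁, hg₂, ha, hb, hw2] at e2
  refine ⟨?_, ?_⟩
  · rw [e1]; field_simp; ring
  · rw [e2]; field_simp; ring

/-- **Pinning read at an inert prime.** If `heckeLFunction ψ s = V.LSeries s` for `re s > s₀` and the
rational place `v` (prime `ℓ`) is inert in `K` with the single place `w` above it (residue degree two,
`ψ` unramified at `w`), then `a_{ℓ²}(V) = ψ(ϖ_w)` (the only ideal of norm `ℓ²` is `𝔭_w`).
[cite: Ribet1977Nebentypus, §3 Thm. (3.4) and Cor. (3.5)] [cite: NeukirchANT1999, Ch. VII §8 (8.1)] -/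
theorem coeff_of_pinned_inert (ψ : HeckeCharacter K) (V : WeierstrassCurve ℚ) (s₀ : ℝ)
    (h : ∀ s : ℂ, s₀ < s.re → heckeLFunction ψ s = V.LSeries s)
    (v : HeightOneSpectrum (𝓞 ℚ)) {w : HeightOneSpectrum (𝓞 K)}
    (hS : {w : HeightOneSpectrum (𝓞 K) | w.asIdeal.under (𝓞 ℚ) = v.asIdeal} = {w})
    (hw : w.asIdeal.inertiaDeg (𝓞 ℚ) = 2) (hψ : ψ.IsUnramifiedAt w) :
    ((V.LFunction (Rat.HeightOneSpectrum.natGenerator v ^ 2) : ℤ) : ℂ) = ψ.valueAtUniformizer w := by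
  obtain ⟨σ, ψ₀, 𝔪, -, h𝔪, hiff, -, hval, hcoeff⟩ :=
    Rigidity.intCast_lFunction_eq_weightedCoeff_of_heckeLFunction_eq_LSeries ψ V s₀ h
  set ℓ : ℕ := Rat.HeightOneSpectrum.natGenerator v with hℓ
  have hℓp : ℓ.Prime := Rat.HeightOneSpectrum.prime_natGenerator v
  set g : Ideal (𝓞 K) →*₀ ℂ := rayClassCoeffHom 𝔪 fun v ↦ ψ₀.valueAtUniformizer v
  have hmul : ∀ A B : Ideal (𝓞 K), A ≠ ⊥ → B ≠ ⊥ → g (A * B) = g A * g B := fun A B _ _ ↦ map_mul g A B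
  have hone : g ⊤ = 1 := by rw [← Ideal.one_eq_top, map_one]
  have hsum : NumberField.twistCount K g (ℓ ^ 2) = g w.asIdeal := by
    have h1 := (finsum_absNorm_eq_prime_pow_of_singleton g hmul hone v hS hw 1).1
    rw [mul_one, pow_one] at h1
    rw [Rigidity.twistCount_eq_finsum, hℓ]
    exact h1
  have hg : g w.asIdeal = ψ₀.valueAtUniformizer w := Rigidity.rayClassCoeffHom_asIdeal _ ((hiff w).mp hψ) h𝔪
  have hm : w.asIdeal.under (𝓞 ℚ) = v.asIdeal := by
    have : w ∈ {w : HeightOneSpectrum (𝓞 K) | w.asIdeal.under (𝓞 ℚ) = v.asIdeal} := by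
      rw [hS]; exact Set.mem_singleton _
    exact this
  have hwv : w.under (𝓞 ℚ) = v :=
    HeightOneSpectrum.ext (by rw [HeightOneSpectrum.under_asIdeal]; exact hm)
  have hN : ((Ideal.absNorm w.asIdeal : ℕ) : ℂ) = ((ℓ ^ 2 : ℕ) : ℂ) := by
    rw [absNorm_asIdeal_eq_natGenerator_pow, hwv, hw]
  have hX : ((ℓ ^ 2 : ℕ) : ℂ) ≠ 0 := by exact_mod_cast pow_ne_zero 2 hℓp.ne_zero
  have hXσ : ((ℓ ^ 2 : ℕ) : ℂ) ^ (σ : ℂ) * ((ℓ ^ 2 : ℕ) : ℂ) ^ (-(σ : ℂ)) = 1 := by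
    rw [Complex.cpow_neg, mul_inv_cancel₀]
    exact fun h0 ↦ hX ((Complex.cpow_eq_zero_iff _ _).mp h0).1
  have e2 := hcoeff (ℓ ^ 2) (pow_ne_zero 2 hℓp.ne_zero)
  rw [hsum, hg, hval, hN, mul_assoc, hXσ, mul_one] at e2
  exact e2

/-- **Value pairs under a twist relation (split prime).** Two characters `ψ`, `ψ'` pinned to curves
`V`, `V'` over `ℚ` whose coefficients at `ℓ`, `ℓ²` are related by `a_ℓ(V) = J a_ℓ(V')`,
`a_{ℓ²}(V) = a_{ℓ²}(V')` with `J² = 1` have, at a split `ℓ = w₁ w₂`, `{ψ(w₁), ψ(w₂)} = {J ψ'(w₁), J ψ'(w₂)}`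
as unordered pairs (equal sums and products; Vieta). [cite: Ribet1977Nebentypus, §3 Thm. (3.4)] -/
theorem valuePair_of_pinned_twist_split (ψ ψ' : HeckeCharacter K) (V V' : WeierstrassCurve ℚ)
    (s₀ s₀' : ℝ) (h : ∀ s : ℂ, s₀ < s.re → heckeLFunction ψ s = V.LSeries s)
    (h' : ∀ s : ℂ, s₀' < s.re → heckeLFunction ψ' s = V'.LSeries s)
    (v : HeightOneSpectrum (𝓞 ℚ)) {w₁ w₂ : HeightOneSpectrum (𝓞 K)} (hne : w₁ ≠ w₂)
    (hS : {w : HeightOneSpectrum (𝓞 K) | w.asIdeal.under (𝓞 ℚ) = v.asIdeal} = {w₁, w₂})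
    (h₁ : w₁.asIdeal.inertiaDeg (𝓞 ℚ) = 1) (h₂ : w₂.asIdeal.inertiaDeg (𝓞 ℚ) = 1)
    (hψ₁ : ψ.IsUnramifiedAt w₁) (hψ₂ : ψ.IsUnramifiedAt w₂)
    (hψ'₁ : ψ'.IsUnramifiedAt w₁) (hψ'₂ : ψ'.IsUnramifiedAt w₂) {J : ℂ} (hJ : J ^ 2 = 1)
    (ht1 : ((V.LFunction (Rat.HeightOneSpectrum.natGenerator v) : ℤ) : ℂ) =
      J * ((V'.LFunction (Rat.HeightOneSpectrum.natGenerator v) : ℤ) : ℂ))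
    (ht2 : ((V.LFunction (Rat.HeightOneSpectrum.natGenerator v ^ 2) : ℤ) : ℂ) =
      ((V'.LFunction (Rat.HeightOneSpectrum.natGenerator v ^ 2) : ℤ) : ℂ)) :
    (ψ.valueAtUniformizer w₁ = J * ψ'.valueAtUniformizer w₁ ∧
        ψ.valueAtUniformizer w₂ = J * ψ'.valueAtUniformizer w₂) ∨
      (ψ.valueAtUniformizer w₁ = J * ψ'.valueAtUniformizer w₂ ∧
        ψ.valueAtUniformizer w₂ = J * ψ'.valueAtUniformizer w₁) := by
  obtain ⟨hsum, hsq⟩ := coeff_of_pinned_split ψ V s₀ h v hne hS h₁ h₂ hψ₁ hψ₂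
  obtain ⟨hsum', hsq'⟩ := coeff_of_pinned_split ψ' V' s₀' h' v hne hS h₁ h₂ hψ'₁ hψ'₂
  set a := ψ.valueAtUniformizer w₁
  set b := ψ.valueAtUniformizer w₂
  set c := ψ'.valueAtUniformizer w₁
  set d := ψ'.valueAtUniformizer w₂
  have hs : a + b = J * c + J * d := by rw [← hsum, ht1, hsum']; ring
  have hq : a ^ 2 + a * b + b ^ 2 = (J * c) ^ 2 + (J * c) * (J * d) + (J * d) ^ 2 := by
    rw [← hsq, ht2, hsq']
    linear_combination -(c ^ 2 + c * d + d ^ 2) * hJ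
  have hp : a * b = (J * c) * (J * d) := by
    linear_combination (a + b + J * c + J * d) * hs - hq
  exact Rigidity.pair_eq_of_sum_eq_of_mul_eq hs hp

/-- **Values under a twist relation (inert prime).** Same data at an inert `ℓ` (single place `w` of
residue degree two): `ψ(w) = ψ'(w)` (both are `a_{ℓ²}`). [cite: Ribet1977Nebentypus, §3 Cor. (3.5)] -/
theorem value_of_pinned_twist_inert (ψ ψ' : HeckeCharacter K) (V V' : WeierstrassCurve ℚ)
    (s₀ s₀' : ℝ) (h : ∀ s : ℂ, s₀ < s.re → heckeLFunction ψ s = V.LSeries s)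
    (h' : ∀ s : ℂ, s₀' < s.re → heckeLFunction ψ' s = V'.LSeries s)
    (v : HeightOneSpectrum (𝓞 ℚ)) {w : HeightOneSpectrum (𝓞 K)}
    (hS : {w : HeightOneSpectrum (𝓞 K) | w.asIdeal.under (𝓞 ℚ) = v.asIdeal} = {w})
    (hw : w.asIdeal.inertiaDeg (𝓞 ℚ) = 2) (hψ : ψ.IsUnramifiedAt w) (hψ' : ψ'.IsUnramifiedAt w)
    (ht2 : ((V.LFunction (Rat.HeightOneSpectrum.natGenerator v ^ 2) : ℤ) : ℂ) =
      ((V'.LFunction (Rat.HeightOneSpectrum.natGenerator v ^ 2) : ℤ) : ℂ)) :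
    ψ.valueAtUniformizer w = ψ'.valueAtUniformizer w := by
  rw [← coeff_of_pinned_inert ψ V s₀ h v hS hw hψ, ht2, coeff_of_pinned_inert ψ' V' s₀' h' v hS hw hψ']

end Pinned

/-! ## §3. The base curve `cm7 = 49a1`: twist parameter, Deuring's character, unramifiedness off `7` -/

section Base

/-- **The twist parameter of a curve with `j = −3375`.** Every elliptic curve `V₁/ℚ` with
`j(V₁) = −3375 = j(cm7)` satisfies `a_{ℓ^e}(V₁) = (D/ℓ)^e · a_{ℓ^e}(cm7)` at every odd prime `ℓ ∤ D`,
for an integer `D ≠ 0` which is `≡ 1 (mod 4)` or a fundamental discriminant: `V₁ ≅ cm7^{(d)}` with `d`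
squarefree (Silverman X.5 Cor. 5.4.1), `D = d` or `4d`, and the twist changes `a_{ℓ^e}` by `(d/ℓ)^e`
whatever the reduction (AEC X.2, Exercise 10.16). [cite: SilvermanAEC2009, X.5 Cor. 5.4.1 and X.2 Exercise 10.16] -/
theorem exists_twistParam_of_j_eq (V₁ : WeierstrassCurve ℚ) [V₁.IsElliptic] (hj : V₁.j = -3375) :
    ∃ D : ℤ, D ≠ 0 ∧ (D % 4 = 1 ∨ IsFundamentalDiscriminant D) ∧
      ∀ v : HeightOneSpectrum (𝓞 ℚ), Rat.HeightOneSpectrum.natGenerator v ≠ 2 →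
        ¬ ((Rat.HeightOneSpectrum.natGenerator v : ℕ) : ℤ) ∣ D →
        ∀ e : ℕ, V₁.LFunction (Rat.HeightOneSpectrum.natGenerator v ^ e) =
          J(D | Rat.HeightOneSpectrum.natGenerator v) ^ e *
            cm7.LFunction (Rat.HeightOneSpectrum.natGenerator v ^ e) := by
  have hjj : V₁.j = cm7.j := by rw [hj, j_cm7]
  have h0 : cm7.j ≠ 0 := by rw [j_cm7]; norm_num
  have h1728 : cm7.j ≠ 1728 := by rw [j_cm7]; norm_num
  obtain ⟨d, hd0, hsq, C, hC⟩ := exists_variableChange_eq_quadraticTwist_intCast_of_j_eq hjj h0 h1728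
  -- the `L`-function of `V₁` is that of `cm7^{(d)}`, and of `cm7^{(4d)}`
  have hLd : V₁.LFunction = (cm7.quadraticTwist (d : ℚ)).LFunction := by
    rw [← hC, LFunction_smul]
  obtain ⟨C', hC'⟩ := cm7.exists_variableChange_quadraticTwist_mul_sq (d : ℚ) 2 two_ne_zero
  haveI : (cm7.quadraticTwist (d : ℚ)).IsElliptic :=
    cm7.isElliptic_quadraticTwist (by exact_mod_cast hd0)
  have hL4d : V₁.LFunction = (cm7.quadraticTwist ((4 * d : ℤ) : ℚ)).LFunction := by
    rw [hLd, ← LFunction_smul (cm7.quadraticTwist (d : ℚ)) C', hC']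
    congr 2
    push_cast; ring
  -- the twist formula at odd `ℓ ∤ D`
  have key : ∀ (D : ℤ), V₁.LFunction = (cm7.quadraticTwist (D : ℚ)).LFunction →
      ∀ v : HeightOneSpectrum (𝓞 ℚ), Rat.HeightOneSpectrum.natGenerator v ≠ 2 →
        ¬ ((Rat.HeightOneSpectrum.natGenerator v : ℕ) : ℤ) ∣ D →
        ∀ e : ℕ, V₁.LFunction (Rat.HeightOneSpectrum.natGenerator v ^ e) =
          J(D | Rat.HeightOneSpectrum.natGenerator v) ^ e *
            cm7.LFunction (Rat.HeightOneSpectrum.natGenerator v ^ e) := by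
    intro D hL v hv2 hvD e
    rw [hL]
    exact cm7.LFunction_quadraticTwist_intCast_apply_prime_pow_of_not_dvd D v hv2 hvD e
  by_cases h4 : d % 4 = 1
  · exact ⟨d, hd0, Or.inl h4, key d hLd⟩
  · refine ⟨4 * d, mul_ne_zero four_ne_zero hd0, Or.inr (Or.inr ⟨dvd_mul_right 4 d, ?_, ?_⟩), key (4 * d) hL4d⟩
    · have h40 : ¬ (4 : ℤ) ∣ d := fun h4 ↦ by
        have h := hsq 2 (by simpa [show (2 : ℤ) * 2 = 4 by norm_num] using h4)
        rw [Int.isUnit_iff] at h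
        omega
      rw [Int.mul_ediv_cancel_left d four_ne_zero]
      omega
    · rw [Int.mul_ediv_cancel_left d four_ne_zero]; exact hsq

/-- `j(cm7) = −3375` is a maximal-order CM invariant. [cite: SilvermanATAEC1994, App. A §3] -/
theorem j_cm7_mem_maximalCMJInvariants : cm7.j ∈ maximalCMJInvariants := by
  rw [j_cm7, maximalCMJInvariants]; simp

/-- `d_K(cm7) = −7`. [cite: SilvermanATAEC1994, App. A §3] -/
theorem cmFieldDiscrOfJ_cm7 : cmFieldDiscrOfJ cm7.j = -7 := by
  rw [j_cm7, cmFieldDiscrOfJ]; norm_num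

/-- The maximal-order `j`-invariant with CM field `ℚ(√−7)` is `−3375`. [cite: SilvermanATAEC1994, App. A §3] -/
theorem j_eq_of_mem_maximalCMJInvariants_of_cmFieldDiscrOfJ {V₁ : WeierstrassCurve ℚ} [V₁.IsElliptic]
    (hjm : V₁.j ∈ maximalCMJInvariants) (hj : cmFieldDiscrOfJ V₁.j = -7) : V₁.j = -3375 := by
  simp only [maximalCMJInvariants, Finset.mem_insert, Finset.mem_singleton] at hjm
  rcases hjm with h | h | h | h | h | h | h | h | h <;>
    first
    | exact h
    | (exfalso; rw [h] at hj; norm_num [cmFieldDiscrOfJ] at hj)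

variable {K : Type} [Field K] [NumberField K]

/-- A place `w ∌ 7` of `K` lies over a rational prime `ℓ ≠ 7`. [folklore] -/
theorem natGenerator_under_ne_of_notMem (w : HeightOneSpectrum (𝓞 K)) {p : ℕ}
    (hw : ((p : ℕ) : 𝓞 K) ∉ w.asIdeal) : Rat.HeightOneSpectrum.natGenerator (w.under (𝓞 ℚ)) ≠ p := by
  intro h
  apply hw
  rw [← h]
  exact (asIdeal_under_eq_iff_natCast_mem (w.under (𝓞 ℚ)) w).mp (HeightOneSpectrum.under_asIdeal _ _).symm

/-- **`cm7_K` has good reduction at every place `w ∌ 7`** (`Δ(49a1) = −7³`). [cite: Cremona1997, Table 1 (curve 49a1)] -/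
theorem hasGoodReductionAt_baseChange_cm7 (w : HeightOneSpectrum (𝓞 K)) (hw : ((7 : ℕ) : 𝓞 K) ∉ w.asIdeal) :
    (cm7.baseChange K).HasGoodReductionAt w := by
  set v : HeightOneSpectrum (𝓞 ℚ) := w.under (𝓞 ℚ) with hv
  haveI : w.asIdeal.LiesOver v.asIdeal := ⟨rfl⟩
  set ℓ : ℕ := Rat.HeightOneSpectrum.natGenerator v with hℓ
  haveI : Fact ℓ.Prime := ⟨Rat.HeightOneSpectrum.prime_natGenerator v⟩
  have hℓ7 : ℓ ≠ 7 := natGenerator_under_ne_of_notMem w hw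
  haveI := cm7_isGloballyMinimal
  have hgood : cm7.HasGoodReductionAt v :=
    (hasGoodReductionAtPrime_primesEquiv_iff_holds cm7 v ℓ rfl).mp (cm7_hasGoodReductionAtPrime ℓ hℓ7)
  exact hasGoodReductionAt_baseChange_of_hasGoodReductionAt_rat cm7 v w hgood

/-- **Deuring's character of `cm7` over `K = ℚ(√−7)`** (from the PLAIN fact): for `K` imaginary quadratic
with `d_K = −7` and `c ≠ 1` there is `ψ₇` of infinity type `(1,0)`, `c`-equivariant, pinned to `cm7`, and
unramified at every place `w ∌ 7`. [cite: SilvermanATAEC1994, Ch. II Thm. 9.2 and Thm. 10.5] -/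
theorem exists_pinned_cm7 (hDe : Deuring_exists_heckeCharacter_of_maximalCM) (hK : IsImaginaryQuadratic K)
    (hdK : NumberField.discr K = -7) (c : K ≃ₐ[ℚ] K) (hc : c ≠ 1) :
    ∃ ψ₇ : HeckeCharacter K, ψ₇.HasInfinityType (fun _ ↦ 1) (fun _ ↦ 0) ∧ IsHeckeConjEquivariant c ψ₇ ∧
      (∀ s : ℂ, 3 / 2 < s.re → heckeLFunction ψ₇ s = cm7.LSeries s) ∧
      ∀ w : HeightOneSpectrum (𝓞 K), ((7 : ℕ) : 𝓞 K) ∉ w.asIdeal → ψ₇.IsUnramifiedAt w := by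
  haveI := cm7_isGloballyMinimal
  have hKj : IsCMFieldOfJ K cm7.j :=
    QuadraticRamification.isCMFieldOfJ_of_discr_eq j_cm7_mem_maximalCMJInvariants cmFieldDiscrOfJ_cm7 hK.1 hdK
  obtain ⟨ψ, hinf, heq, hunr, -, hpin⟩ := hDe cm7 j_cm7_mem_maximalCMJInvariants K hKj c hc
  exact ⟨ψ, hinf, heq, hpin, fun w hw ↦ (hunr w).mpr (hasGoodReductionAt_baseChange_cm7 w hw)⟩

end Base

end TwistTransport

end Summit.BirchSwinnertonDyer.BirchSwinnertonDyer.Theorems.RamifiedSevenEllipticUnits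

end
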